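import Summits.ValiantsHypothesis.ValiantsHypothesis.Theorems.MonotoneRestorationOrbitRestorationQPValueTerms
import HarnessLib

/-!
# Canonical terms of a value derivation: equivariance and values (symmetrisation in ORBIT currency, III)

Route MonotoneRestoration, crux `OrbitRestorationQP` (stmt-ValiantsHypothesis-18293), namespace
`Summit.ValiantsHypothesis.ValiantsHypothesis.Theorems.ValueDerivation`.

For the canonical terms `tm q` of the values `q ∈ U = Γ • S` of a value derivation
(`…ValueDerivation.lean`, `…ValueTerms.lean`):

* `act_tm` — **equivariance**: `act δ (tm q) = tm (δ • q)` (the least-rank witnesses of `δ • q` are the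
  translates of those of `q`, and the one-step unfoldings transport); `act_summands`, `act_sNode`;
* `val_tm` — **values** (characteristic `0`): `(tm q).val = q` (every least witness contributes `q`, and
  the average of `N_q` copies of `q` is `q`);
* `ncard_orbit_le_of_mem_U` — the `Γ`-orbit of a value of `U` is the orbit of a value of `S`.

Everything is proved. [folklore]

## References
* A. Dawar, G. Wilsenach, *Symmetric arithmetic circuits*, ToC 21 (2025), Defs. 2.2, 3.6, 3.7, §3.3.
  [DawarWilsenach2025]
-/

noncomputable section

open scoped Classical

-- `Summit.ValiantsHypothesis.ValiantsHypothesis.…` is the tree's single-conjunct layout (Sub = Summit).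
set_option linter.dupNamespace false

namespace Summit.ValiantsHypothesis.ValiantsHypothesis.Theorems

open HTerm

universe u v w

namespace ValueDerivation

variable {K : Type u} {X : Type v} [Field K] (𝒟 : ValueDerivation K X)
variable {Γ : Type w} [Group Γ] [Fintype Γ] [MulAction Γ X]

/-! ### Equivariance -/

omit [Field K] [Fintype Γ] in
/-- `act` on a variable leaf. [folklore] -/
@[simp] theorem act_var (δ : Γ) (x : X) : act δ (HTerm.var x : HTerm K X) = HTerm.var (δ • x) := by
  simp [act, HTerm.rename]

omit [Field K] [Fintype Γ] in
/-- `act` on a constant leaf. [folklore] -/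
@[simp] theorem act_const (δ : Γ) (c : K) : act δ (HTerm.const c : HTerm K X) = HTerm.const c := by
  simp [act, HTerm.rename]

omit [Fintype Γ] in
/-- Contributions transport: acting on the contribution of a step gives the contribution of the
transported step, provided the operand terms transport. [folklore] -/
theorem map_act_contrib (δ : Γ) {t : MvPolynomial X K → HTerm K X} (d : StepData K X)
    (h : ∀ u ∈ d.args, act δ (t u) = t (ren δ u)) :
    (contrib t d).map (act δ) = contrib t (d.map δ) := by
  cases d with
  | var x => simp [contrib, StepData.map]
  | const c => simp [contrib, StepData.map]
  | sum D =>
    simp only [contrib, StepData.map, Multiset.map_map, Function.comp_def]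
    refine Multiset.map_congr rfl fun cu hcu => ?_
    rw [act_mkNode]
    congr 1
    simp only [Multiset.insert_eq_cons, Multiset.map_cons, Multiset.map_singleton, act_const]
    rw [h cu.2 (by simpa [StepData.args] using ⟨cu.1, hcu⟩)]
  | prod u v =>
    simp only [contrib, StepData.map, Multiset.map_singleton]
    rw [act_mkNode]
    congr 1
    simp only [Multiset.insert_eq_cons, Multiset.map_cons, Multiset.map_singleton]
    rw [h u (by simp [StepData.args]), h v (by simp [StepData.args])]

/-- The summands transport, provided the operand terms of the least witnesses transport. [folklore] -/
theorem map_act_summands (δ : Γ) {t : MvPolynomial X K → HTerm K X} (q : MvPolynomial X K)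
    (h : ∀ w ∈ 𝒟.W Γ q, ∀ u ∈ ((𝒟.stepOf w.2).map w.1).args, act δ (t u) = t (ren δ u)) :
    (𝒟.summands Γ t q).map (act δ) = 𝒟.summands Γ t (ren δ q) := by
  simp only [summands, Multiset.map_add, Multiset.map_singleton, act_const]
  congr 1
  rw [← Multiset.coe_mapAddMonoidHom, map_sum, W_ren, Finset.sum_map]
  refine Finset.sum_congr rfl fun w hw => ?_
  simp only [Multiset.coe_mapAddMonoidHom, Function.Embedding.coeFn_mk]
  rw [map_act_contrib δ _ (h w hw), ← StepData.map_mul]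

/-- The body transports, provided the operand terms of the least witnesses transport. [folklore] -/
theorem act_body (δ : Γ) {t : MvPolynomial X K → HTerm K X} (q : MvPolynomial X K)
    (h : ∀ w ∈ 𝒟.W Γ q, ∀ u ∈ ((𝒟.stepOf w.2).map w.1).args, act δ (t u) = t (ren δ u)) :
    act δ (𝒟.body Γ t q) = 𝒟.body Γ t (ren δ q) := by
  rw [body, body, act_mkNode, card_W_ren]
  congr 1
  simp only [Multiset.insert_eq_cons, Multiset.map_cons, Multiset.map_singleton, act_const, act_mkNode]
  rw [𝒟.map_act_summands δ q h]

/-- **Equivariance of the canonical terms**: `act δ (tm q) = tm (δ • q)` for `q ∈ U`. [folklore] -/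
theorem act_tm (δ : Γ) {q : MvPolynomial X K} (hq : q ∈ 𝒟.U Γ) : act δ (𝒟.tm Γ q) = 𝒟.tm Γ (ren δ q) := by
  induction hn : 𝒟.rU Γ q using Nat.strong_induction_on generalizing q with
  | _ n ih =>
    rw [𝒟.tm_unfold q, 𝒟.tm_unfold (ren δ q)]
    refine 𝒟.act_body δ q fun w hw u hu => ?_
    obtain ⟨huU, hlt⟩ := 𝒟.args_step_W hw hu
    exact ih _ (hn ▸ hlt) huU rfl

/-- The summands of the canonical term transport. [folklore] -/
theorem act_summands (δ : Γ) (q : MvPolynomial X K) :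
    (𝒟.summands Γ (𝒟.tm Γ) q).map (act δ) = 𝒟.summands Γ (𝒟.tm Γ) (ren δ q) :=
  𝒟.map_act_summands δ q fun _ hw _ hu => 𝒟.act_tm δ (𝒟.args_step_W hw hu).1

variable (Γ) in
/-- The averaging (sum) node of `q`. [folklore] -/
def sNode (q : MvPolynomial X K) : HTerm K X := mkNode false (𝒟.summands Γ (𝒟.tm Γ) q)

/-- The canonical term is `N_q⁻¹ · sNode q`. [folklore] -/
theorem tm_eq (q : MvPolynomial X K) :
    𝒟.tm Γ q = mkNode true {HTerm.const (((𝒟.W Γ q).card : K)⁻¹), 𝒟.sNode Γ q} :=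
  𝒟.tm_unfold q

/-- The averaging node transports. [folklore] -/
theorem act_sNode (δ : Γ) (q : MvPolynomial X K) : act δ (𝒟.sNode Γ q) = 𝒟.sNode Γ (ren δ q) := by
  rw [sNode, act_mkNode, act_summands, sNode]

/-! ### Values -/

/-- Value of a contribution: the value of the step, provided the operand terms have the right values.
[folklore] -/
theorem sum_val_contrib {t : MvPolynomial X K → HTerm K X} (d : StepData K X)
    (h : ∀ u ∈ d.args, (t u).val = u) : ((contrib t d).map val).sum = d.value := by
  cases d with
  | var x => simp [contrib, StepData.value]
  | const c => simp [contrib, StepData.value]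
  | sum D =>
    simp only [contrib, StepData.value, Multiset.map_map, Function.comp_def]
    congr 1
    refine Multiset.map_congr rfl fun cu hcu => ?_
    rw [val_mkNode_true]
    simp only [Multiset.insert_eq_cons, Multiset.map_cons, Multiset.map_singleton, Multiset.prod_cons,
      Multiset.prod_singleton, val_const]
    rw [h cu.2 (by simpa [StepData.args] using ⟨cu.1, hcu⟩)]
  | prod u v =>
    simp only [contrib, StepData.value, Multiset.map_singleton, Multiset.sum_singleton]
    rw [val_mkNode_true]
    simp only [Multiset.insert_eq_cons, Multiset.map_cons, Multiset.map_singleton, Multiset.prod_cons,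
      Multiset.prod_singleton]
    rw [h u (by simp [StepData.args]), h v (by simp [StepData.args])]

/-- Value of the averaging node: `N_q • q`, provided the operand terms have the right values. [folklore] -/
theorem val_sNode_of {t : MvPolynomial X K → HTerm K X} (q : MvPolynomial X K)
    (h : ∀ w ∈ 𝒟.W Γ q, ∀ u ∈ ((𝒟.stepOf w.2).map w.1).args, (t u).val = u) :
    (mkNode false (𝒟.summands Γ t q)).val = ((𝒟.W Γ q).card : K) • q := by
  rw [val_mkNode_false, summands, Multiset.map_add, Multiset.sum_add, Multiset.map_singleton,
    Multiset.sum_singleton, val_const, map_zero, zero_add, ← Multiset.coe_mapAddMonoidHom, map_sum,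
    Multiset.sum_sum]
  simp only [Multiset.coe_mapAddMonoidHom]
  rw [Finset.sum_congr rfl fun w hw => (sum_val_contrib _ (h w hw)).trans (𝒟.value_step_W hw),
    Finset.sum_const, Nat.cast_smul_eq_nsmul]

/-- Value of the body: `q`, for `q ∈ U`, provided the operand terms have the right values
(characteristic `0`: `N_q ≥ 1` is invertible). [folklore] -/
theorem val_body_of [CharZero K] {t : MvPolynomial X K → HTerm K X} {q : MvPolynomial X K}
    (hq : q ∈ 𝒟.U Γ) (h : ∀ w ∈ 𝒟.W Γ q, ∀ u ∈ ((𝒟.stepOf w.2).map w.1).args, (t u).val = u) :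
    (𝒟.body Γ t q).val = q := by
  rw [body, val_mkNode_true]
  simp only [Multiset.insert_eq_cons, Multiset.map_cons, Multiset.map_singleton, Multiset.prod_cons,
    Multiset.prod_singleton, val_const]
  have h0 : ((𝒟.W Γ q).card : K) ≠ 0 := Nat.cast_ne_zero.2 (Finset.card_pos.2 (𝒟.W_nonempty hq)).ne'
  rw [𝒟.val_sNode_of q h, MvPolynomial.smul_eq_C_mul, ← mul_assoc, ← map_mul, inv_mul_cancel₀ h0,
    map_one, one_mul]

/-- **The canonical term of a value computes the value** (`q ∈ U`, characteristic `0`). [folklore] -/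
theorem val_tm [CharZero K] {q : MvPolynomial X K} (hq : q ∈ 𝒟.U Γ) : (𝒟.tm Γ q).val = q := by
  induction hn : 𝒟.rU Γ q using Nat.strong_induction_on generalizing q with
  | _ n ih =>
    rw [𝒟.tm_unfold q]
    refine 𝒟.val_body_of hq fun w hw u hu => ?_
    obtain ⟨huU, hlt⟩ := 𝒟.args_step_W hw hu
    exact ih _ (hn ▸ hlt) huU rfl

/-! ### Orbits of values -/

omit [Fintype Γ] in
/-- The `Γ`-orbit of a translate is the `Γ`-orbit. [folklore] -/
theorem range_ren_ren (γ : Γ) (p : MvPolynomial X K) :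
    (Set.range fun δ : Γ => ren δ (ren γ p)) = Set.range fun δ : Γ => ren δ p := by
  ext q
  simp only [Set.mem_range]
  constructor
  · rintro ⟨δ, rfl⟩; exact ⟨δ * γ, ren_mul δ γ p⟩
  · rintro ⟨δ, rfl⟩; exact ⟨δ * γ⁻¹, by rw [ren_mul, ren_inv_ren]⟩

/-- **Orbits of values of `U` are orbits of values of `S`**: a bound on the latter bounds the former.
[folklore] -/
theorem ncard_orbit_le_of_mem_U {B : ℕ} (hS : ∀ p ∈ 𝒟.S, (Set.range fun δ : Γ => ren δ p).ncard ≤ B)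
    {q : MvPolynomial X K} (hq : q ∈ 𝒟.U Γ) : (Set.range fun δ : Γ => ren δ q).ncard ≤ B := by
  obtain ⟨γ, p, hp, rfl⟩ := 𝒟.mem_U.1 hq
  rw [range_ren_ren]
  exact hS p hp

end ValueDerivation

end Summit.ValiantsHypothesis.ValiantsHypothesis.Theorems

end
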